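import Literature.Analysis.FunctionSpaces.HolderManifoldSurjectivity
import Literature.Analysis.FunctionSpaces.HolderManifoldLaplacianLocality
import Literature.Analysis.FunctionSpaces.HolderManifoldModelSolvability
import HarnessLib

/-!
# `L₀ = Δ_g − 1 : C^{2,r}_𝔄 → C^{0,r}_𝔄` is bijective given the Schauder estimate (Hölder spaces, part 25)

Topic `Literature/Analysis/FunctionSpaces`. Assembly of parts 16 (injectivity by the maximum
principle), 22 (surjectivity from an a-priori estimate, smooth solvability and locality), 23
(locality of `Δ_g`) and 24 (smooth solvability of `Δ_g u − u = f`): on a closed Riemannian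
manifold modelled on `ℝ^m`, `m ≥ 1`, with Hölder chart data `𝔄` and `0 < r ≤ 1`, IF the Schauder
estimate `‖u‖_{C^{2,r}_𝔄} ≤ C ‖(Δ_g − 1)u‖_{C^{0,r}_𝔄}` holds, then `L₀ = Δ_g − 1` is a bijection
(hence, by the open mapping theorem, a Banach isomorphism) `C^{2,r}_𝔄(M) → C^{0,r}_𝔄(M)` —
the reference operator of the method of continuity (Gilbarg–Trudinger 2001, Thm. 5.2 / Thm. 6.14;
`Literature.Analysis.OperatorTheory.MethodOfContinuity`).

* `modelOperator_surjective_of_estimate`, `modelOperator_bijective_of_estimate`,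
  `exists_modelOperator_continuousLinearEquiv_of_estimate`.

This is census item (2c) of `Literature.Geometry.Riemannian.gurskyViaclovsky_pathOpen_weighted_four`,
closed modulo the Schauder estimate (2a), which enters as the hypothesis `hest`. Everything is
proved; no named facts.

## References

* D. Gilbarg, N. S. Trudinger, *Elliptic Partial Differential Equations of Second Order* (2001),
  Thm. 5.2, §6.3, Thm. 6.14. [GilbargTrudinger2001]
-/

noncomputable section

open Set Filter Function
open scoped NNReal Topology Manifold ContDiff

namespace Literature.Analysis.FunctionSpaces

open Literature.Geometry.Lorentzian PseudoRiemannianMetric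

variable {m : ℕ} {M : Type*} [TopologicalSpace M] [T2Space M] [CompactSpace M]
  [ChartedSpace (EuclideanSpace ℝ (Fin m)) M] [IsManifold (𝓡 m) ∞ M]
  {ι : Type*} [Fintype ι] (𝔄 : HolderChartData ι (EuclideanSpace ℝ (Fin m)) M)
  (g : PseudoRiemannianMetric (𝓡 m) ∞ (EuclideanSpace ℝ (Fin m)) (TangentSpace (𝓡 m) : M → Type _))
  [g.HasLeviCivita] {r : ℝ≥0}

/-- **`L₀ = Δ_g − 1 : C^{2,r}_𝔄 → C^{0,r}_𝔄` is onto, given the Schauder estimate.**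
[cite: GilbargTrudinger2001, §6.3, Thm. 6.14] -/
theorem modelOperator_surjective_of_estimate (hm : 0 < m) (hg : g.IsRiemannian) (hr0 : 0 < r)
    (hr : r ≤ 1) {C : ℝ}
    (hest : ∀ u : HolderManifoldFunction 𝔄 ℝ (0 + 2) r, ‖u‖ ≤ C * ‖modelOperatorCLM 𝔄 g hr u‖) :
    Function.Surjective (modelOperatorCLM (k := 0) 𝔄 g hr) :=
  HolderManifoldFunction.surjective_of_estimate_of_smooth 𝔄 hr0 hr (modelOperatorCLM 𝔄 g hr)
    hest (fun f hf => exists_modelOperator_eq_of_smooth 𝔄 g hm hg hr f hf)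
    (fun u v h x => tendsto_modelOperator_of_tendstoUniformly_piece 𝔄 g hr u v h x)

/-- **`L₀ = Δ_g − 1 : C^{2,r}_𝔄 → C^{0,r}_𝔄` is bijective, given the Schauder estimate**
(injective by the maximum principle, part 16). [cite: GilbargTrudinger2001, §6.3, Thm. 6.14] -/
theorem modelOperator_bijective_of_estimate (hm : 0 < m) (hg : g.IsRiemannian) (hr0 : 0 < r)
    (hr : r ≤ 1) {C : ℝ}
    (hest : ∀ u : HolderManifoldFunction 𝔄 ℝ (0 + 2) r, ‖u‖ ≤ C * ‖modelOperatorCLM 𝔄 g hr u‖) :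
    Function.Bijective (modelOperatorCLM (k := 0) 𝔄 g hr) :=
  ⟨modelOperator_injective 𝔄 g hg hr, modelOperator_surjective_of_estimate 𝔄 g hm hg hr0 hr hest⟩

/-- **`L₀` as a Banach isomorphism, given the Schauder estimate** (open mapping theorem).
[cite: GilbargTrudinger2001, Thm. 5.2, Thm. 6.14] -/
theorem exists_modelOperator_continuousLinearEquiv_of_estimate (hm : 0 < m) (hg : g.IsRiemannian)
    (hr0 : 0 < r) (hr : r ≤ 1) {C : ℝ}
    (hest : ∀ u : HolderManifoldFunction 𝔄 ℝ (0 + 2) r, ‖u‖ ≤ C * ‖modelOperatorCLM 𝔄 g hr u‖) :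
    ∃ e : HolderManifoldFunction 𝔄 ℝ (0 + 2) r ≃L[ℝ] HolderManifoldFunction 𝔄 ℝ 0 r,
      ∀ u, e u = modelOperatorCLM 𝔄 g hr u := by
  have hb := modelOperator_bijective_of_estimate 𝔄 g hm hg hr0 hr hest
  refine ⟨ContinuousLinearEquiv.ofBijective (modelOperatorCLM (k := 0) 𝔄 g hr)
    (LinearMap.ker_eq_bot.2 hb.1) (LinearMap.range_eq_top.2 hb.2), fun u => rfl⟩

end Literature.Analysis.FunctionSpaces

end
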